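import Literature.MathematicalPhysics.QuantumLattice.HubbardCorrelatorCertificateAffine
import Literature.MathematicalPhysics.QuantumLattice.InfVolFermionStateHubbardMeanEnergyBox
import HarnessLib

/-!
# The kinetic energy density of translation-invariant states and of torus-limit ground states
# of the Hubbard model

Topic `Literature/MathematicalPhysics/QuantumLattice`; namespace
`Literature.MathematicalPhysics.QuantumLattice` (the file path). Companion of
`InfVolFermionStateHubbardMeanEnergyBox` (`ω(E_Φ) = ω(Φ{0}) + Σ_i ω(Φ{0, e_i})` for
translation-invariant `ω`), `HubbardCorrelatorCertificate(Affine)` (torus-limit ground states carry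
the thermodynamic energy density; certified correlator intervals) and of the bundle
papers/HubbardSuperconductivity/manybody-bootstrap/ (format `certsdp/1` §6: the KINETIC rows
`…_Klo/_Kup`, objective `a · (h₀ − U n_{0↑} n_{0↓})`).

For the Hubbard interaction `Φ` on `ℤ^d` (hopping `t`, repulsion `U`) the mean-energy observable is
`E_Φ = U n_{0↑}n_{0↓} + ½ Σ_{±e_i} (hopping through 0)`, so for every TRANSLATION-INVARIANT state
`e(ω) = Re ω(E_Φ) = U · D_ω + k_ω`, with the double occupancy `D_ω = Re ω(n_{0↑} n_{0↓})` and the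
KINETIC ENERGY DENSITY `k_ω = -t Σ_{i=1}^{d} Σ_σ Re (ω(c†_{0σ} c_{e_iσ}) + ω(c†_{e_iσ} c_{0σ}))`
(Bratteli–Robinson II §6.2.4: the mean energy of a periodic state through its finite-range terms;
the two half bonds through the origin in direction `i` have equal expectation). For a torus-limit
ground state `e(ω)` is the thermodynamic ground-state energy density
(`IsTorusLimitOf.hubbardEnergyDensity_eq_energyDensity2D_of_isGroundState`), hence

  `k_ω = e(t,U,1) − U · D_ω`   (square lattice, half filling; chain: `e_chain(t,U) − U · D_ω`),

which is the dictionary entry for the bundle's kinetic rows: a certified interval for `D_ω` and a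
certified bracket for the energy density give a certified interval for `k_ω` and conversely
(the corollaries `…_le_of_le_docc` / `…_ge_of_docc_le` below). Everything is PROVED; no definition,
no named fact.

## Results

* `IsTranslationInvariant.hubbardEnergyDensity_eq_docc_add_hopping` (every `d`):
  `e(ω) = U Re ω(n_{0↑}n_{0↓}) + Σ_i (-t) Σ_σ (Re ω(c†_{0σ}c_{e_iσ}) + Re ω(c†_{e_iσ}c_{0σ}))`.
* `re_expect_hoppingWindow_two`: on the square lattice the eight hopping words read in the window
  `{0, e₁, e₂}` (the support of the bundle's kinetic objective) have the same total expectation as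
  the bond-by-bond sum (compatibility of the local functionals along isotony).
* `IsTorusLimitOf.neg_t_mul_re_expect_hoppingWindow_eq` (square lattice, half filling, even `L`):
  `-t · Re ω(Σ words) = energyDensity2D t U 1 − U · Re ω(n_{0↑}n_{0↓})`; chain form
  `IsTorusLimitOf.hubbard_hopping_eq_hubbardChainEnergyDensity_sub`.
* `IsTorusLimitOf.neg_t_mul_re_expect_hoppingWindow_le_of_le_docc` / `…_ge_of_docc_le`: certified
  `D_ω ≥ lo`, `e ≤ u` ⇒ `k_ω ≤ u − U lo`; certified `D_ω ≤ hi`, `e ≥ e₋` ⇒ `k_ω ≥ e₋ − U hi`.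
* `re_expect_hoppingWords_two`, `IsTorusLimitOf.neg_t_mul_re_expect_hoppingWords_two_eq`: the same
  objective written, as in the bundle's kinetic rows, as the LIST of its eight normal-ordered words
  with a common coefficient (under any state; for torus-limit ground states; the operator identity
  in `𝔄_{\{0,e₁,e₂\}}` behind them is the private `hoppingWords_two_eq_smul_sum`), with arbitrary
  membership proofs so that the rows' own abbreviations are instances.
-/

noncomputable section

namespace Literature.MathematicalPhysics.QuantumLattice

open Matrix Finset HubbardWave0 Literature.Probability.LatticeModels
open Filter _root_.Topology
open scoped ComplexOrder BigOperators

namespace InfVolFermionState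

variable {d : ℕ}

/-! ### The energy density of a translation-invariant state, term by term (every dimension) -/

/-- **The Hubbard energy density of a translation-invariant state, term by term** (every
dimension `d`): `e(ω) = U Re ω(n_{0↑}n_{0↓}) + Σ_i (-t) Σ_σ (Re ω(c†_{0σ} c_{e_iσ}) + Re ω(c†_{e_iσ} c_{0σ}))`
(`IsTranslationInvariant.expect_hubbard_meanEnergyObs` with the on-site and bond terms
`hubbardFermionInteraction_apply_singleton/_pair`; the square-lattice case is
`IsTranslationInvariant.hubbardEnergyDensity_eq_terms`). [cite: BratteliRobinsonII1997, §6.2.4] -/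
theorem IsTranslationInvariant.hubbardEnergyDensity_eq_docc_add_hopping {ω : InfVolFermionState d}
    (hω : ω.IsTranslationInvariant) (t U : ℝ) :
    ω.hubbardEnergyDensity t U =
      U * (ω.expect {0} (nAt 0 (mem_singleton_self 0) 0 * nAt 0 (mem_singleton_self 0) 1)).re +
        ∑ i : Fin d, -t * ∑ σ : Fin 2,
          ((ω.expect {0, 0 + unitVec i}
              ((cAt 0 (mem_insert_self _ _) σ)ᴴ *
                cAt (0 + unitVec i) (mem_insert_of_mem (mem_singleton_self _)) σ)).re +
            (ω.expect {0, 0 + unitVec i}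
              ((cAt (0 + unitVec i) (mem_insert_of_mem (mem_singleton_self _)) σ)ᴴ *
                cAt 0 (mem_insert_self _ _) σ)).re) := by
  rw [hubbardEnergyDensity, meanEnergy, hω.expect_hubbard_meanEnergyObs t U, Complex.add_re, Complex.re_sum,
    hubbardFermionInteraction_apply_singleton, map_smul, smul_eq_mul, Complex.re_ofReal_mul]
  congr 1
  refine Finset.sum_congr rfl fun i _ => ?_
  rw [hubbardFermionInteraction_apply_pair, map_smul, map_sum, smul_eq_mul, ← Complex.ofReal_neg,
    Complex.re_ofReal_mul, Complex.re_sum]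
  simp only [map_add, Complex.add_re]

/-! ### The square lattice: the hopping words in the window `{0, e₁, e₂}` -/

/-- `0 ∈ {0, e₁, e₂}` (file-private plumbing; any membership proof may be used in its place, by proof
irrelevance). [folklore] -/
private theorem zero_mem_hoppingWindow_two : (0 : Site 2) ∈ ({0, unitVec 0, unitVec 1} : Finset (Site 2)) :=
  mem_insert_self _ _

/-- `e₁ ∈ {0, e₁, e₂}`. [folklore] -/
private theorem unitVec_zero_mem_hoppingWindow_two : unitVec 0 ∈ ({0, unitVec 0, unitVec 1} : Finset (Site 2)) :=
  mem_insert_of_mem (mem_insert_self _ _)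

/-- `e₂ ∈ {0, e₁, e₂}`. [folklore] -/
private theorem unitVec_one_mem_hoppingWindow_two : unitVec 1 ∈ ({0, unitVec 0, unitVec 1} : Finset (Site 2)) :=
  mem_insert_of_mem (mem_insert_of_mem (mem_singleton_self _))

/-- `e_i ∈ {0, e₁, e₂}` (`i = 1, 2`). [folklore] -/
private theorem unitVec_mem_hoppingWindow_two (i : Fin 2) : unitVec i ∈ ({0, unitVec 0, unitVec 1} : Finset (Site 2)) := by
  fin_cases i
  · exact unitVec_zero_mem_hoppingWindow_two
  · exact unitVec_one_mem_hoppingWindow_two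

/-- The bond region `{0, 0 + e_i}` lies in the window `{0, e₁, e₂}`. [folklore] -/
private theorem pair_subset_hoppingWindow_two (i : Fin 2) :
    ({0, 0 + unitVec i} : Finset (Site 2)) ⊆ {0, unitVec 0, unitVec 1} := by
  refine insert_subset zero_mem_hoppingWindow_two (singleton_subset_iff.2 ?_)
  rw [zero_add]
  exact unitVec_mem_hoppingWindow_two i

/-- **The eight hopping words read in the window `{0, e₁, e₂}`** have the same expectation as the
bond-by-bond sum: for EVERY state `ω` of the lattice fermion system on `ℤ²`,
`Re ω_{\{0,e₁,e₂\}}(Σ_i Σ_σ (c†_{0σ} c_{e_iσ} + c†_{e_iσ} c_{0σ})) = Σ_i Σ_σ (Re ω_{\{0,e_i\}}(c†_{0σ} c_{e_iσ}) + Re ω_{\{0,e_i\}}(c†_{e_iσ} c_{0σ}))`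
(compatibility `ω_{Λ'} ∘ Γ(Λ ⊆ Λ') = ω_Λ` of the local functionals, Bratteli–Robinson I §2.6 /
Araki–Moriya §4). This is the support on which the bundle's kinetic objective is written
(format `certsdp/1` §6, rows `…_Klo/_Kup`). [cite: BratteliRobinsonI1987, §2.6.1] -/
theorem re_expect_hoppingWindow_two (ω : InfVolFermionState 2) :
    (ω.expect ({0, unitVec 0, unitVec 1} : Finset (Site 2))
        (∑ i : Fin 2, ∑ σ : Fin 2,
          ((cAt 0 zero_mem_hoppingWindow_two σ)ᴴ * cAt (unitVec i) (unitVec_mem_hoppingWindow_two i) σ +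
            (cAt (unitVec i) (unitVec_mem_hoppingWindow_two i) σ)ᴴ * cAt 0 zero_mem_hoppingWindow_two σ))).re =
      ∑ i : Fin 2, ∑ σ : Fin 2,
        ((ω.expect {0, 0 + unitVec i}
            ((cAt 0 (mem_insert_self _ _) σ)ᴴ *
              cAt (0 + unitVec i) (mem_insert_of_mem (mem_singleton_self _)) σ)).re +
          (ω.expect {0, 0 + unitVec i}
            ((cAt (0 + unitVec i) (mem_insert_of_mem (mem_singleton_self _)) σ)ᴴ *
              cAt 0 (mem_insert_self _ _) σ)).re) := by
  -- each window word is the isotony image of the corresponding bond word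
  have hword : ∀ (i σ : Fin 2),
      (cAt 0 zero_mem_hoppingWindow_two σ)ᴴ * cAt (unitVec i) (unitVec_mem_hoppingWindow_two i) σ +
          (cAt (unitVec i) (unitVec_mem_hoppingWindow_two i) σ)ᴴ * cAt 0 zero_mem_hoppingWindow_two σ =
        fermionEmbed (PolySite.incl (pair_subset_hoppingWindow_two i))
          ((cAt 0 (mem_insert_self _ _) σ)ᴴ *
              cAt (0 + unitVec i) (mem_insert_of_mem (mem_singleton_self _)) σ +
            (cAt (0 + unitVec i) (mem_insert_of_mem (mem_singleton_self _)) σ)ᴴ *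
              cAt 0 (mem_insert_self _ _) σ) := by
    intro i σ
    have h0 : cAt (0 : Site 2) (pair_subset_hoppingWindow_two i (mem_insert_self _ _)) σ =
        cAt 0 zero_mem_hoppingWindow_two σ := rfl
    have h1 : cAt (0 + unitVec i) (pair_subset_hoppingWindow_two i (mem_insert_of_mem (mem_singleton_self _))) σ =
        cAt (unitVec i) (unitVec_mem_hoppingWindow_two i) σ :=
      cAt_congr _ _ (zero_add _) σ
    rw [fermionEmbed_add, fermionEmbed_mul, fermionEmbed_mul, fermionEmbed_conjTranspose,
      fermionEmbed_conjTranspose, fermionEmbed_incl_cAt, fermionEmbed_incl_cAt, h0, h1]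
  simp_rw [hword]
  rw [map_sum, Complex.re_sum]
  refine Finset.sum_congr rfl fun i _ => ?_
  rw [map_sum, Complex.re_sum]
  refine Finset.sum_congr rfl fun σ _ => ?_
  rw [ω.compatible, map_add, Complex.add_re]

/-- **The kinetic energy density of a translation-invariant state on the square lattice, in the
window `{0, e₁, e₂}`**: `e(ω) = U Re ω(n_{0↑}n_{0↓}) − t Re ω_{\{0,e₁,e₂\}}(Σ_i Σ_σ (c†_{0σ}c_{e_iσ} + h.c.))`.
[cite: BratteliRobinsonII1997, §6.2.4] -/
theorem IsTranslationInvariant.hubbardEnergyDensity_eq_docc_sub_hoppingWindow {ω : InfVolFermionState 2}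
    (hω : ω.IsTranslationInvariant) (t U : ℝ) :
    ω.hubbardEnergyDensity t U =
      U * (ω.expect {0} (nAt 0 (mem_singleton_self 0) 0 * nAt 0 (mem_singleton_self 0) 1)).re +
        -t * (ω.expect ({0, unitVec 0, unitVec 1} : Finset (Site 2))
          (∑ i : Fin 2, ∑ σ : Fin 2,
            ((cAt 0 zero_mem_hoppingWindow_two σ)ᴴ * cAt (unitVec i) (unitVec_mem_hoppingWindow_two i) σ +
              (cAt (unitVec i) (unitVec_mem_hoppingWindow_two i) σ)ᴴ * cAt 0 zero_mem_hoppingWindow_two σ))).re := by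
  rw [hω.hubbardEnergyDensity_eq_docc_add_hopping t U, re_expect_hoppingWindow_two, Finset.mul_sum]

/-! ### Torus-limit ground states: kinetic energy = energy density − U · double occupancy -/

/-- **Kinetic energy density of a torus-limit half-filled ground state of the square lattice.**
For `ω` a torus limit of normalised `L²`-particle ground states of `hamiltonian (fermionTorusGraph 2 L) t U`
along even `L → ∞` (`U ≥ 0`):
`-t · Re ω_{\{0,e₁,e₂\}}(Σ_i Σ_σ (c†_{0σ}c_{e_iσ} + c†_{e_iσ}c_{0σ})) = energyDensity2D t U 1 − U · Re ω(n_{0↑}n_{0↓})`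
(translation invariance of torus limits, `hubbardEnergyDensity_eq_docc_sub_hoppingWindow`, and
`IsTorusLimitOf.hubbardEnergyDensity_eq_energyDensity2D_of_isGroundState`). This is the reading of
the bundle's kinetic rows: `k_ω = e − U D_ω`. [cite: BratteliRobinsonII1997, §6.2.4] -/
theorem IsTorusLimitOf.neg_t_mul_re_expect_hoppingWindow_eq {ω : InfVolFermionState 2}
    {ψ : ∀ L, Fock (Orb (FermionTorus 2 L))} {Ls : ℕ → ℕ}
    (h : ω.IsTorusLimitOf ψ Ls) (hLs : Tendsto Ls atTop atTop) (hev : ∀ j, Even (Ls j))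
    (t : ℝ) {U : ℝ} (hU : 0 ≤ U)
    (hψ : ∀ j, _root_.Literature.MathematicalPhysics.QuantumLattice.IsGroundState
      (hamiltonian (fermionTorusGraph 2 (Ls j)) t U) (Ls j ^ 2) (ψ (Ls j)))
    (h1 : ∀ j, star (ψ (Ls j)) ⬝ᵥ ψ (Ls j) = 1) :
    -t * (ω.expect ({0, unitVec 0, unitVec 1} : Finset (Site 2))
        (∑ i : Fin 2, ∑ σ : Fin 2,
          ((cAt 0 zero_mem_hoppingWindow_two σ)ᴴ * cAt (unitVec i) (unitVec_mem_hoppingWindow_two i) σ +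
            (cAt (unitVec i) (unitVec_mem_hoppingWindow_two i) σ)ᴴ * cAt 0 zero_mem_hoppingWindow_two σ))).re =
      ThermodynamicLimit.energyDensity2D t U 1 -
        U * (ω.expect {0} (nAt 0 (mem_singleton_self 0) 0 * nAt 0 (mem_singleton_self 0) 1)).re := by
  have he := h.hubbardEnergyDensity_eq_energyDensity2D_of_isGroundState hLs hev t hU hψ h1
  have ht := h.isTranslationInvariant.hubbardEnergyDensity_eq_docc_sub_hoppingWindow t U
  linarith

/-- **Kinetic energy density of a torus-limit half-filled ground state of the chain**:
`-t Σ_σ (Re ω(c†_{0σ}c_{1σ}) + Re ω(c†_{1σ}c_{0σ})) = hubbardChainEnergyDensity t U − U · Re ω(n_{0↑}n_{0↓})`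
for `ω` a torus limit of normalised `L`-particle ground states of the rings `ℤ/Lℤ` (`U ≥ 0`).
[cite: BratteliRobinsonII1997, §6.2.4] -/
theorem IsTorusLimitOf.hubbard_hopping_eq_hubbardChainEnergyDensity_sub {ω : InfVolFermionState 1}
    {ψ : ∀ L, Fock (Orb (FermionTorus 1 L))} {Ls : ℕ → ℕ}
    (h : ω.IsTorusLimitOf ψ Ls) (hLs : Tendsto Ls atTop atTop) (t : ℝ) {U : ℝ} (hU : 0 ≤ U)
    (hψ : ∀ j, _root_.Literature.MathematicalPhysics.QuantumLattice.IsGroundState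
      (hamiltonian (fermionTorusGraph 1 (Ls j)) t U) (Ls j) (ψ (Ls j)))
    (h1 : ∀ j, star (ψ (Ls j)) ⬝ᵥ ψ (Ls j) = 1) :
    -t * ∑ σ : Fin 2,
        ((ω.expect {0, 0 + unitVec 0}
            ((cAt 0 (mem_insert_self _ _) σ)ᴴ *
              cAt (0 + unitVec 0) (mem_insert_of_mem (mem_singleton_self _)) σ)).re +
          (ω.expect {0, 0 + unitVec 0}
            ((cAt (0 + unitVec 0) (mem_insert_of_mem (mem_singleton_self _)) σ)ᴴ *
              cAt 0 (mem_insert_self _ _) σ)).re) =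
      ThermodynamicLimit.hubbardChainEnergyDensity t U -
        U * (ω.expect {0} (nAt 0 (mem_singleton_self 0) 0 * nAt 0 (mem_singleton_self 0) 1)).re := by
  have he := h.hubbardEnergyDensity_eq_hubbardChainEnergyDensity hLs t hU hψ h1
  have ht := h.isTranslationInvariant.hubbardEnergyDensity_eq_docc_add_hopping t U
  rw [Fin.sum_univ_one] at ht
  linarith

/-! ### Certified intervals: kinetic energy from double occupancy and the energy bracket -/

/-- **A certified floor on the double occupancy and a certified ceiling on the energy density
bound the kinetic energy density from above**: for a torus-limit half-filled ground state `ω` of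
the square lattice (hypotheses of `neg_t_mul_re_expect_hoppingWindow_eq`), `energyDensity2D t U 1 ≤ u`
and `lo ≤ Re ω(n_{0↑}n_{0↓})` with `U ≥ 0` give `k_ω ≤ u − U · lo` (the bundle's `_Dlo` row and
energy upper bound re-read as a kinetic ceiling). [cite: WangEtAl2024, §III] -/
theorem IsTorusLimitOf.neg_t_mul_re_expect_hoppingWindow_le_of_le_docc {ω : InfVolFermionState 2}
    {ψ : ∀ L, Fock (Orb (FermionTorus 2 L))} {Ls : ℕ → ℕ}
    (h : ω.IsTorusLimitOf ψ Ls) (hLs : Tendsto Ls atTop atTop) (hev : ∀ j, Even (Ls j))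
    (t : ℝ) {U : ℝ} (hU : 0 ≤ U)
    (hψ : ∀ j, _root_.Literature.MathematicalPhysics.QuantumLattice.IsGroundState
      (hamiltonian (fermionTorusGraph 2 (Ls j)) t U) (Ls j ^ 2) (ψ (Ls j)))
    (h1 : ∀ j, star (ψ (Ls j)) ⬝ᵥ ψ (Ls j) = 1) {u lo : ℝ}
    (hu : ThermodynamicLimit.energyDensity2D t U 1 ≤ u)
    (hlo : lo ≤ (ω.expect {0} (nAt 0 (mem_singleton_self 0) 0 * nAt 0 (mem_singleton_self 0) 1)).re) :
    -t * (ω.expect ({0, unitVec 0, unitVec 1} : Finset (Site 2))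
        (∑ i : Fin 2, ∑ σ : Fin 2,
          ((cAt 0 zero_mem_hoppingWindow_two σ)ᴴ * cAt (unitVec i) (unitVec_mem_hoppingWindow_two i) σ +
            (cAt (unitVec i) (unitVec_mem_hoppingWindow_two i) σ)ᴴ * cAt 0 zero_mem_hoppingWindow_two σ))).re ≤
      u - U * lo := by
  rw [h.neg_t_mul_re_expect_hoppingWindow_eq hLs hev t hU hψ h1]
  nlinarith [mul_le_mul_of_nonneg_left hlo hU]

/-- **A certified ceiling on the double occupancy and a certified floor on the energy density
bound the kinetic energy density from below**: `e₋ ≤ energyDensity2D t U 1` and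
`Re ω(n_{0↑}n_{0↓}) ≤ hi` with `U ≥ 0` give `e₋ − U · hi ≤ k_ω` for every torus-limit half-filled
ground state `ω` (the bundle's `_Dup` row and thermodynamic-limit energy floor re-read as a kinetic
floor). [cite: WangEtAl2024, §III] -/
theorem IsTorusLimitOf.neg_t_mul_re_expect_hoppingWindow_ge_of_docc_le {ω : InfVolFermionState 2}
    {ψ : ∀ L, Fock (Orb (FermionTorus 2 L))} {Ls : ℕ → ℕ}
    (h : ω.IsTorusLimitOf ψ Ls) (hLs : Tendsto Ls atTop atTop) (hev : ∀ j, Even (Ls j))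
    (t : ℝ) {U : ℝ} (hU : 0 ≤ U)
    (hψ : ∀ j, _root_.Literature.MathematicalPhysics.QuantumLattice.IsGroundState
      (hamiltonian (fermionTorusGraph 2 (Ls j)) t U) (Ls j ^ 2) (ψ (Ls j)))
    (h1 : ∀ j, star (ψ (Ls j)) ⬝ᵥ ψ (Ls j) = 1) {elo hi : ℝ}
    (he : elo ≤ ThermodynamicLimit.energyDensity2D t U 1)
    (hhi : (ω.expect {0} (nAt 0 (mem_singleton_self 0) 0 * nAt 0 (mem_singleton_self 0) 1)).re ≤ hi) :
    elo - U * hi ≤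
      -t * (ω.expect ({0, unitVec 0, unitVec 1} : Finset (Site 2))
        (∑ i : Fin 2, ∑ σ : Fin 2,
          ((cAt 0 zero_mem_hoppingWindow_two σ)ᴴ * cAt (unitVec i) (unitVec_mem_hoppingWindow_two i) σ +
            (cAt (unitVec i) (unitVec_mem_hoppingWindow_two i) σ)ᴴ * cAt 0 zero_mem_hoppingWindow_two σ))).re := by
  rw [h.neg_t_mul_re_expect_hoppingWindow_eq hLs hev t hU hψ h1]
  nlinarith [mul_le_mul_of_nonneg_left hhi hU]

/-! ### The kinetic objective word by word (the eight normal-ordered hopping words of the window)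

The bundle's kinetic rows (format `certsdp/1` §6, objective `a·(h₀ − U n_{0↑}n_{0↓})`, rows
`…_Klo` with `a = 1` and `…_Kup` with `a = -1` after the sign convention `E_cert ≤ ω(objective)`)
write the objective not as the double sum above but as the LIST of its eight normal-ordered words,
each carrying the coefficient `-a·t` (here named `a`), in the fixed order
`c†_{0↑}c_{e₂↑}, c†_{0↑}c_{e₁↑}, c†_{0↓}c_{e₂↓}, c†_{0↓}c_{e₁↓}, c†_{e₂↑}c_{0↑}, c†_{e₂↓}c_{0↓}, c†_{e₁↑}c_{0↑}, c†_{e₁↓}c_{0↓}`.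
The statements below identify that polynomial with `a •` the window hopping operator (a private
identity in the local algebra `𝔄_{\{0,e₁,e₂\}}`, then under any state, then for torus-limit ground
states), so that a kinetic row and the corollaries `…_le_of_le_docc` / `…_ge_of_docc_le` speak about
literally the same number. The membership proofs `h0 : 0 ∈ {0,e₁,e₂}` and `hi i : e_i ∈ {0,e₁,e₂}` are
ARBITRARY (binders): by proof irrelevance every choice gives the same operators, so the statements
apply verbatim to abbreviations such as `c_{xσ} := cAt x ‹x ∈ {0,e₁,e₂}› σ` made elsewhere. -/

end InfVolFermionState

/-- **The eight hopping words with a common coefficient sum to `a •` the window hopping operator**: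
in `𝔄_{\{0,e₁,e₂\}}`, for every `a : ℂ` and any membership proofs,
`a•c†_{0↑}c_{e₂↑} + a•c†_{0↑}c_{e₁↑} + a•c†_{0↓}c_{e₂↓} + a•c†_{0↓}c_{e₁↓} + a•c†_{e₂↑}c_{0↑} + a•c†_{e₂↓}c_{0↓} + a•c†_{e₁↑}c_{0↑} + a•c†_{e₁↓}c_{0↓}
  = a • Σ_{i=1,2} Σ_σ (c†_{0σ}c_{e_iσ} + c†_{e_iσ}c_{0σ})`
(the word order and bracketing are those of the bundle's kinetic rows; pure bookkeeping in the
module `𝔄_Λ` — file-private plumbing: `simp only [Fin.sum_univ_two, smul_add]; abel` proves it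
anywhere; the public statements are the two expectation identities below). [folklore] -/
private theorem hoppingWords_two_eq_smul_sum (a : ℂ)
    (h0 : (0 : Site 2) ∈ ({0, unitVec 0, unitVec 1} : Finset (Site 2)))
    (hi : ∀ i : Fin 2, unitVec i ∈ ({0, unitVec 0, unitVec 1} : Finset (Site 2))) :
    a • ((cAt 0 h0 0)ᴴ * cAt (unitVec 1) (hi 1) 0) +
        a • ((cAt 0 h0 0)ᴴ * cAt (unitVec 0) (hi 0) 0) +
        a • ((cAt 0 h0 1)ᴴ * cAt (unitVec 1) (hi 1) 1) +
        a • ((cAt 0 h0 1)ᴴ * cAt (unitVec 0) (hi 0) 1) +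
        a • ((cAt (unitVec 1) (hi 1) 0)ᴴ * cAt 0 h0 0) +
        a • ((cAt (unitVec 1) (hi 1) 1)ᴴ * cAt 0 h0 1) +
        a • ((cAt (unitVec 0) (hi 0) 0)ᴴ * cAt 0 h0 0) +
        a • ((cAt (unitVec 0) (hi 0) 1)ᴴ * cAt 0 h0 1) =
      a • ∑ i : Fin 2, ∑ σ : Fin 2,
        ((cAt 0 h0 σ)ᴴ * cAt (unitVec i) (hi i) σ + (cAt (unitVec i) (hi i) σ)ᴴ * cAt 0 h0 σ) := by
  simp only [Fin.sum_univ_two, smul_add]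
  abel

namespace InfVolFermionState

/-- **Expectation of the eight-word kinetic polynomial in any state**: for every state `ω` of the
lattice fermion system on `ℤ²`, every rational coefficient `q` and any membership proofs,
`Re ω_{\{0,e₁,e₂\}}(q•c†_{0↑}c_{e₂↑} + ⋯ + q•c†_{e₁↓}c_{0↓}) = q · Re ω_{\{0,e₁,e₂\}}(Σ_i Σ_σ (c†_{0σ}c_{e_iσ} + c†_{e_iσ}c_{0σ}))`
(linearity of the local functional `ω_Λ`). With `q = ∓t` the left-hand side is `± k_ω` for
translation-invariant `ω` (`hubbardEnergyDensity_eq_docc_sub_hoppingWindow`).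
[cite: BratteliRobinsonII1997, §6.2.4] -/
theorem re_expect_hoppingWords_two (ω : InfVolFermionState 2) (q : ℚ)
    (h0 : (0 : Site 2) ∈ ({0, unitVec 0, unitVec 1} : Finset (Site 2)))
    (hi : ∀ i : Fin 2, unitVec i ∈ ({0, unitVec 0, unitVec 1} : Finset (Site 2))) :
    (ω.expect ({0, unitVec 0, unitVec 1} : Finset (Site 2))
        (((q : ℚ) : ℂ) • ((cAt 0 h0 0)ᴴ * cAt (unitVec 1) (hi 1) 0) +
          ((q : ℚ) : ℂ) • ((cAt 0 h0 0)ᴴ * cAt (unitVec 0) (hi 0) 0) +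
          ((q : ℚ) : ℂ) • ((cAt 0 h0 1)ᴴ * cAt (unitVec 1) (hi 1) 1) +
          ((q : ℚ) : ℂ) • ((cAt 0 h0 1)ᴴ * cAt (unitVec 0) (hi 0) 1) +
          ((q : ℚ) : ℂ) • ((cAt (unitVec 1) (hi 1) 0)ᴴ * cAt 0 h0 0) +
          ((q : ℚ) : ℂ) • ((cAt (unitVec 1) (hi 1) 1)ᴴ * cAt 0 h0 1) +
          ((q : ℚ) : ℂ) • ((cAt (unitVec 0) (hi 0) 0)ᴴ * cAt 0 h0 0) +
          ((q : ℚ) : ℂ) • ((cAt (unitVec 0) (hi 0) 1)ᴴ * cAt 0 h0 1))).re =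
      q * (ω.expect ({0, unitVec 0, unitVec 1} : Finset (Site 2))
        (∑ i : Fin 2, ∑ σ : Fin 2,
          ((cAt 0 h0 σ)ᴴ * cAt (unitVec i) (hi i) σ + (cAt (unitVec i) (hi i) σ)ᴴ * cAt 0 h0 σ))).re := by
  rw [hoppingWords_two_eq_smul_sum, map_smul, smul_eq_mul, ← Complex.ofReal_ratCast,
    Complex.re_ofReal_mul]

/-- **The bundle's kinetic rows read as energy-density statements**: for `ω` a torus limit of
normalised `L²`-particle ground states of `hamiltonian (fermionTorusGraph 2 L) t U` along even
`L → ∞` (`U ≥ 0`), every rational `q` and any membership proofs,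
`-t · Re ω_{\{0,e₁,e₂\}}(q•c†_{0↑}c_{e₂↑} + ⋯ + q•c†_{e₁↓}c_{0↓}) = q · (energyDensity2D t U 1 − U · Re ω(n_{0↑}n_{0↓}))`;
at `t = 1` a `…_Klo` row (`q = -1`) is thus a certified floor on `e(1,U,1) − U·D_ω` and a `…_Kup` row
(`q = 1`) a certified ceiling (`re_expect_hoppingWords_two` and `neg_t_mul_re_expect_hoppingWindow_eq`).
[cite: WangEtAl2024, §III] -/
theorem IsTorusLimitOf.neg_t_mul_re_expect_hoppingWords_two_eq {ω : InfVolFermionState 2}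
    {ψ : ∀ L, Fock (Orb (FermionTorus 2 L))} {Ls : ℕ → ℕ}
    (h : ω.IsTorusLimitOf ψ Ls) (hLs : Tendsto Ls atTop atTop) (hev : ∀ j, Even (Ls j))
    (t : ℝ) {U : ℝ} (hU : 0 ≤ U)
    (hψ : ∀ j, _root_.Literature.MathematicalPhysics.QuantumLattice.IsGroundState
      (hamiltonian (fermionTorusGraph 2 (Ls j)) t U) (Ls j ^ 2) (ψ (Ls j)))
    (h1 : ∀ j, star (ψ (Ls j)) ⬝ᵥ ψ (Ls j) = 1) (q : ℚ)
    (h0 : (0 : Site 2) ∈ ({0, unitVec 0, unitVec 1} : Finset (Site 2)))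
    (hi : ∀ i : Fin 2, unitVec i ∈ ({0, unitVec 0, unitVec 1} : Finset (Site 2))) :
    -t * (ω.expect ({0, unitVec 0, unitVec 1} : Finset (Site 2))
        (((q : ℚ) : ℂ) • ((cAt 0 h0 0)ᴴ * cAt (unitVec 1) (hi 1) 0) +
          ((q : ℚ) : ℂ) • ((cAt 0 h0 0)ᴴ * cAt (unitVec 0) (hi 0) 0) +
          ((q : ℚ) : ℂ) • ((cAt 0 h0 1)ᴴ * cAt (unitVec 1) (hi 1) 1) +
          ((q : ℚ) : ℂ) • ((cAt 0 h0 1)ᴴ * cAt (unitVec 0) (hi 0) 1) +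
          ((q : ℚ) : ℂ) • ((cAt (unitVec 1) (hi 1) 0)ᴴ * cAt 0 h0 0) +
          ((q : ℚ) : ℂ) • ((cAt (unitVec 1) (hi 1) 1)ᴴ * cAt 0 h0 1) +
          ((q : ℚ) : ℂ) • ((cAt (unitVec 0) (hi 0) 0)ᴴ * cAt 0 h0 0) +
          ((q : ℚ) : ℂ) • ((cAt (unitVec 0) (hi 0) 1)ᴴ * cAt 0 h0 1))).re =
      q * (ThermodynamicLimit.energyDensity2D t U 1 -
        U * (ω.expect {0} (nAt 0 (mem_singleton_self 0) 0 * nAt 0 (mem_singleton_self 0) 1)).re) := by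
  have hk := h.neg_t_mul_re_expect_hoppingWindow_eq hLs hev t hU hψ h1
  rw [re_expect_hoppingWords_two, ← hk]
  ring

end InfVolFermionState

end Literature.MathematicalPhysics.QuantumLattice

end
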